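import Summits.SmoothPoincare4.SmoothPoincare4.Theorems.CongruenceShadowsGriffithsHandlebodyExtensionFlowerReduction
import Literature.Topology.FourManifolds.HandlebodyKernelExtensionTorelli
import HarnessLib

/-!
# SmoothPoincare4 / CongruenceShadows — `GriffithsHandlebodyExtension` (item stmt-SmoothPoincare4-15190): the item from the TORELLI criterion on the flower handlebodies alone

Support file (`--supports` stmt-SmoothPoincare4-15190).  It records, against the ROUTE DECLS by
name, the reduction of the item that the realisation theorem now affords
(`Literature/Topology/FourManifolds/HandlebodyAutRealisation.lean`: every automorphism of
`π₁(V, z)`, `z ∈ ∂V`, of a genus-`g` handlebody is induced by a self-diffeomorphism of `V` fixing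
`z` — Zieschang 1964 / Griffiths 1964 §§3–5, proved in the tree by Laudenbach–Poénaru's handle
slides run in dimension `3`; and `HandlebodyKernelExtensionTorelli.lean`: the reduction):

* `griffithsExtension_of_flower_torelli`, `griffithsHandlebodyExtension_of_flower_torelli`,
  `groupTrisection_griffithsHandlebodyExtension_of_flower_torelli` — **the Literature fact and both
  route decls follow from the Torelli criterion (T) in genus `g ≥ 2` alone**: every
  self-diffeomorphism `χ` of the flower surface `∂V_g = ∂(FlowerModel.FlowerHandlebody hg)` fixing
  the north pole `x₀` and acting as the IDENTITY on `π₁(V_g, x₀)` (`incl_# (χ_# a) = incl_# a` for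
  all `a ∈ π₁(∂V_g, x₀)`) extends over `V_g`.  Compared with the based flower criterion `h₂` of
  `griffithsHandlebodyExtension_of_flower_based` (kernel-PRESERVING `ψ`), the hypothesis is cut down
  to the "Torelli" subgroup (Luft's twist group: Luft (1978), Thm. 2.3, generated up to isotopy by
  twists along meridian discs); the quotient `Aut F_g` is realised by the tree.  Genus `1` of the
  fact enters through the unconditional `roundSolidTorus_diffeoExtends_of_map_ker_eq_ker`
  (homothety cover).  A proof `T` of the hypothesis closes stmt-SmoothPoincare4-15190 by
  `griffithsHandlebodyExtension_of_flower_torelli T`.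

References: [GriffithsHB1964Handlebody] main theorem, §§3–6; [Hensel2020HandlebodyPrimer] Cor. 5.11,
Thm. 6.2; [Luft1978] Thm. 2.3; [Zieschang1964].
-/

-- the registered namespace `Summit.SmoothPoincare4.SmoothPoincare4.Theorems` repeats a component
set_option linter.dupNamespace false

noncomputable section

namespace Summit.SmoothPoincare4.SmoothPoincare4.Theorems

open scoped _root_.Manifold _root_.ContDiff
open Literature.Topology.FourManifolds Literature.Topology.FourManifolds.RoundSolidTorusModel
  Literature.Topology.FourManifolds.FlowerModel
open Summit.SmoothPoincare4.SmoothPoincare4.Theses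

/-- **The Literature fact from the Torelli criterion on the flower handlebodies alone**:
`GriffithsExtension` (all genera, all handlebodies, all boundary data, all base points) from (T):
for every `g ≥ 2`, every self-diffeomorphism of the flower surface fixing the north pole and
acting as the identity on `π₁` of the flower handlebody extends over it.  Genus `1` is the tree's
unconditional `roundSolidTorus_diffeoExtends_of_map_ker_eq_ker`; the passage from (T) to the
kernel-preserving criterion is `IsHandlebody.diffeoExtends_of_map_ker_eq_ker_of_torelli`
(realisation of `Aut π₁ V_g` by diffeomorphisms, `IsHandlebody.exists_diffeomorph_mapOfEq_eq`).
[cite: GriffithsHB1964Handlebody, main theorem and §§3–6] [cite: Luft1978, Thm. 2.3] -/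
theorem griffithsExtension_of_flower_torelli
    (hT : ∀ (g : ℕ) (hg : 2 ≤ g)
      (χ : (𝓡∂ 3).boundary (FlowerHandlebody hg) ≃ₘ⟮𝓡 2, 𝓡 2⟯ (𝓡∂ 3).boundary (FlowerHandlebody hg))
      (hχ : χ (northPole hg) = northPole hg),
      (∀ a : FundamentalGroup ((𝓡∂ 3).boundary (FlowerHandlebody hg)) (northPole hg),
        FundamentalGroup.map (⟨(BoundaryManifold.boundaryData 2 (FlowerHandlebody hg)).incl,
            (BoundaryManifold.boundaryData 2 (FlowerHandlebody hg)).continuous_incl⟩ :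
              C((𝓡∂ 3).boundary (FlowerHandlebody hg), FlowerHandlebody hg)) (northPole hg)
            (FundamentalGroup.mapOfEq (⟨χ, χ.continuous⟩ : C(_, _)) hχ a) =
          FundamentalGroup.map (⟨(BoundaryManifold.boundaryData 2 (FlowerHandlebody hg)).incl,
            (BoundaryManifold.boundaryData 2 (FlowerHandlebody hg)).continuous_incl⟩ :
              C((𝓡∂ 3).boundary (FlowerHandlebody hg), FlowerHandlebody hg)) (northPole hg) a) →
      (BoundaryManifold.boundaryData 2 (FlowerHandlebody hg)).DiffeoExtends χ) :
    GriffithsExtension :=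
  griffithsExtension_of_forall_diffeoExtends_of_flower_torelli
    roundSolidTorus_diffeoExtends_of_map_ker_eq_ker hT

/-- **The item from the Torelli criterion on the flower handlebodies alone** (CongruenceShadows
copy of the route decl): if, for every `g ≥ 2`, every self-diffeomorphism `χ` of the flower surface
`∂V_g` fixing the north pole `x₀` and acting as the identity on `π₁(V_g, x₀)` extends over the
flower handlebody `V_g`, then `GriffithsHandlebodyExtension` holds.  The hypothesis is the
"Torelli" clause of Griffiths' theorem for the model `V_g` (Luft's twist group extends), the
residual obligation of the item after the realisation of `Aut π₁ V_g`.
[cite: GriffithsHB1964Handlebody, main theorem and §§3–6] [cite: Hensel2020HandlebodyPrimer, Cor. 5.11 and Thm. 6.2]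
[cite: Luft1978, Thm. 2.3] -/
theorem griffithsHandlebodyExtension_of_flower_torelli
    (hT : ∀ (g : ℕ) (hg : 2 ≤ g)
      (χ : (𝓡∂ 3).boundary (FlowerHandlebody hg) ≃ₘ⟮𝓡 2, 𝓡 2⟯ (𝓡∂ 3).boundary (FlowerHandlebody hg))
      (hχ : χ (northPole hg) = northPole hg),
      (∀ a : FundamentalGroup ((𝓡∂ 3).boundary (FlowerHandlebody hg)) (northPole hg),
        FundamentalGroup.map (⟨(BoundaryManifold.boundaryData 2 (FlowerHandlebody hg)).incl,
            (BoundaryManifold.boundaryData 2 (FlowerHandlebody hg)).continuous_incl⟩ :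
              C((𝓡∂ 3).boundary (FlowerHandlebody hg), FlowerHandlebody hg)) (northPole hg)
            (FundamentalGroup.mapOfEq (⟨χ, χ.continuous⟩ : C(_, _)) hχ a) =
          FundamentalGroup.map (⟨(BoundaryManifold.boundaryData 2 (FlowerHandlebody hg)).incl,
            (BoundaryManifold.boundaryData 2 (FlowerHandlebody hg)).continuous_incl⟩ :
              C((𝓡∂ 3).boundary (FlowerHandlebody hg), FlowerHandlebody hg)) (northPole hg) a) →
      (BoundaryManifold.boundaryData 2 (FlowerHandlebody hg)).DiffeoExtends χ) :
    CongruenceShadows.GriffithsHandlebodyExtension :=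
  griffithsExtension_of_flower_torelli hT

/-- **The item from the Torelli criterion on the flower handlebodies alone** (GroupTrisection copy
of the route decl). [cite: GriffithsHB1964Handlebody, main theorem and §§3–6] -/
theorem groupTrisection_griffithsHandlebodyExtension_of_flower_torelli
    (hT : ∀ (g : ℕ) (hg : 2 ≤ g)
      (χ : (𝓡∂ 3).boundary (FlowerHandlebody hg) ≃ₘ⟮𝓡 2, 𝓡 2⟯ (𝓡∂ 3).boundary (FlowerHandlebody hg))
      (hχ : χ (northPole hg) = northPole hg),
      (∀ a : FundamentalGroup ((𝓡∂ 3).boundary (FlowerHandlebody hg)) (northPole hg),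
        FundamentalGroup.map (⟨(BoundaryManifold.boundaryData 2 (FlowerHandlebody hg)).incl,
            (BoundaryManifold.boundaryData 2 (FlowerHandlebody hg)).continuous_incl⟩ :
              C((𝓡∂ 3).boundary (FlowerHandlebody hg), FlowerHandlebody hg)) (northPole hg)
            (FundamentalGroup.mapOfEq (⟨χ, χ.continuous⟩ : C(_, _)) hχ a) =
          FundamentalGroup.map (⟨(BoundaryManifold.boundaryData 2 (FlowerHandlebody hg)).incl,
            (BoundaryManifold.boundaryData 2 (FlowerHandlebody hg)).continuous_incl⟩ :
              C((𝓡∂ 3).boundary (FlowerHandlebody hg), FlowerHandlebody hg)) (northPole hg) a) →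
      (BoundaryManifold.boundaryData 2 (FlowerHandlebody hg)).DiffeoExtends χ) :
    GroupTrisection.GriffithsHandlebodyExtension :=
  griffithsExtension_of_flower_torelli hT

/-- **The item from the Torelli criterion on ANY one genus-`g` handlebody per `g ≥ 2`**
(CongruenceShadows copy of the route decl; model-free form of
`griffithsHandlebodyExtension_of_flower_torelli`): it suffices to exhibit, for each `g ≥ 2`, some
genus-`g` handlebody `H₀` and some `z₀ ∈ ∂H₀` such that every self-diffeomorphism of `∂H₀` fixing
`z₀` and acting as the identity on `π₁(H₀, z₀)` extends over `H₀`
(`griffithsExtension_of_forall_exists_torelli_model`; genus `1` is the tree's unconditional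
`roundSolidTorus_diffeoExtends_of_map_ker_eq_ker`).  A proof `T` of the hypothesis — on the
flower handlebody, or on an abstract handlebody with chosen Morse data — closes
stmt-SmoothPoincare4-15190 by `griffithsHandlebodyExtension_of_exists_torelli_model T`.
[cite: GriffithsHB1964Handlebody, main theorem and §§3–6] [cite: Hensel2020HandlebodyPrimer, Cor. 5.11 and Thm. 6.2] -/
theorem griffithsHandlebodyExtension_of_exists_torelli_model
    (hT : ∀ g : ℕ, 2 ≤ g → ∃ (H₀ : Type) (_ : TopologicalSpace H₀) (_ : T2Space H₀)
      (_ : SecondCountableTopology H₀) (_ : ChartedSpace (EuclideanHalfSpace 3) H₀)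
      (_ : IsManifold (𝓡∂ 3) ∞ H₀) (_ : IsHandlebody g H₀) (z₀ : (𝓡∂ 3).boundary H₀),
      ∀ (χ : (𝓡∂ 3).boundary H₀ ≃ₘ⟮𝓡 2, 𝓡 2⟯ (𝓡∂ 3).boundary H₀) (hχ : χ z₀ = z₀),
        (∀ a : FundamentalGroup ((𝓡∂ 3).boundary H₀) z₀,
          FundamentalGroup.map
              (⟨(BoundaryManifold.boundaryData 2 H₀).incl,
                (BoundaryManifold.boundaryData 2 H₀).continuous_incl⟩ : C((𝓡∂ 3).boundary H₀, H₀)) z₀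
              (FundamentalGroup.mapOfEq (⟨χ, χ.continuous⟩ : C(_, _)) hχ a) =
            FundamentalGroup.map
              (⟨(BoundaryManifold.boundaryData 2 H₀).incl,
                (BoundaryManifold.boundaryData 2 H₀).continuous_incl⟩ : C((𝓡∂ 3).boundary H₀, H₀)) z₀ a) →
        (BoundaryManifold.boundaryData 2 H₀).DiffeoExtends χ) :
    CongruenceShadows.GriffithsHandlebodyExtension :=
  griffithsExtension_of_forall_exists_torelli_model roundSolidTorus_diffeoExtends_of_map_ker_eq_ker hT

/-- **The item from the Torelli criterion on any one genus-`g` handlebody per `g ≥ 2`**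
(GroupTrisection copy of the route decl). [cite: GriffithsHB1964Handlebody, main theorem and §§3–6] -/
theorem groupTrisection_griffithsHandlebodyExtension_of_exists_torelli_model
    (hT : ∀ g : ℕ, 2 ≤ g → ∃ (H₀ : Type) (_ : TopologicalSpace H₀) (_ : T2Space H₀)
      (_ : SecondCountableTopology H₀) (_ : ChartedSpace (EuclideanHalfSpace 3) H₀)
      (_ : IsManifold (𝓡∂ 3) ∞ H₀) (_ : IsHandlebody g H₀) (z₀ : (𝓡∂ 3).boundary H₀),
      ∀ (χ : (𝓡∂ 3).boundary H₀ ≃ₘ⟮𝓡 2, 𝓡 2⟯ (𝓡∂ 3).boundary H₀) (hχ : χ z₀ = z₀),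
        (∀ a : FundamentalGroup ((𝓡∂ 3).boundary H₀) z₀,
          FundamentalGroup.map
              (⟨(BoundaryManifold.boundaryData 2 H₀).incl,
                (BoundaryManifold.boundaryData 2 H₀).continuous_incl⟩ : C((𝓡∂ 3).boundary H₀, H₀)) z₀
              (FundamentalGroup.mapOfEq (⟨χ, χ.continuous⟩ : C(_, _)) hχ a) =
            FundamentalGroup.map
              (⟨(BoundaryManifold.boundaryData 2 H₀).incl,
                (BoundaryManifold.boundaryData 2 H₀).continuous_incl⟩ : C((𝓡∂ 3).boundary H₀, H₀)) z₀ a) →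
        (BoundaryManifold.boundaryData 2 H₀).DiffeoExtends χ) :
    GroupTrisection.GriffithsHandlebodyExtension :=
  griffithsExtension_of_forall_exists_torelli_model roundSolidTorus_diffeoExtends_of_map_ker_eq_ker hT

end Summit.SmoothPoincare4.SmoothPoincare4.Theorems

end
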